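import Summits.Ventures.HodgeRepro2.T5SU11JacobiPhaseLowerOutside

/-!
# The mean phase OUTSIDE `0 ≤ λ ≤ 2`: `(r + 2c')(r − c')/r³ ≤ ⟨log|a|⟩_{k,λ} ≤ r²/((r − c')²(r + c'))`, and the sharp
next term `k (k ⟨log|a|⟩_{k,λ} − 1) → 2 + λ(λ − 2)/2` for EVERY real `λ`

`T5SU11JacobiPhaseLowerOutside` pins the moment integrals for `λ ≥ 2`, `r = k − 2 > c' = λ(λ − 2)/2`:
`n!/r^{n+1} + c' (n+1)!/r^{n+2} ≤ ∫_0^∞ sⁿ e^{−rs} Φ_λ(s) ds ≤ n!/(r − c')^{n+1}`. Through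
`⟨log|a|⟩_{k,λ} = ∫ s e^{−rs} Φ_λ / ∫ e^{−rs} Φ_λ` (`normalized_moment_eq_phase'`, valid on the whole ray) this gives

  **`(r + 2c')(r − c')/r³ ≤ ⟨log|a|⟩_{k,λ} ≤ r²/((r − c')²(r + c'))`**   (`mean_phase_ge_of_two_le`, `mean_phase_le_of_two_le`),

both sides `= 1/r + c'/r² + O(1/r³)`, hence **`k (k ⟨log|a|⟩_{k,λ} − 1) → 2 + c'`** outside the Jensen range
(`tendsto_mul_mul_mean_phase_sub_one_of_two_le`, `_of_nonpos`; the envelopes in `ε = 1/r`: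
`lower_envelope_eq_of_two_le`, `upper_envelope_eq_of_two_le`) and, with
`T5SU11JacobiPhaseSecondOrder.tendsto_mul_mul_mean_phase_sub_one` on `0 ≤ λ ≤ 2` (`2 − c`, `c = λ(2 − λ)/2 = −c'`), the
UNIFORM statement

  **`k (k ⟨log|a|⟩_{k,λ} − 1) → 2 + λ(λ − 2)/2` for every real `λ`**   (`tendsto_mul_mul_mean_phase_sub_one_all`):

`⟨log|a|⟩_{k,λ} = 1/k + (2 + λ(λ − 2)/2)/k² + o(1/k²)`, the coefficient `λ(λ − 2)/2` being the Casimir-type constant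
that governs the whole chapter. Nothing is claimed about (N).

Blind lane: Mathlib + the HodgeRepro2 prefix only; no sorry; axioms ⊆ {propext, Classical.choice,
Quot.sound}.
-/

namespace Summit.Ventures.HodgeRepro2.T5SU11JacobiMeanPhaseOutside

open MeasureTheory MeasureTheory.Measure Metric Set Filter Topology
open T5SU11Unimodular T5SU11Fibration T5SU11Cartan T5SU11OneParameter T5SU11CartanProjection T5HaarCircle
  T5BergmanCoefficient T5SU11FibrationHaar T5SU11SphericalFunction T5SU11SphericalSymmetry
  T5SU11SphericalBounds T5SU11SphericalContinuous T5SU11SphericalDeriv T5SU11SphericalLipschitz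
  T5SU11JacobiLaplacePhase T5SU11PhaseLawLintegral T5SU11JacobiWeightDerivAll T5SU11JacobiPhaseTailGroup
  T5SU11JacobiPhaseLipschitz T5SU11JacobiPhaseLawRate T5SU11JacobiMeanPhaseRate T5SU11JacobiPhaseSecondOrder
  T5SU11JacobiPhaseLawRateOutside T5SU11JacobiWeightRate T5SU11JacobiPhaseLowerOutside
open scoped Real

/-! ### The envelopes in the variable `ε = 1/r` -/

/-- The lower envelope of the mean phase outside the Jensen range, in `ε = 1/r`:
`(r + 2)((r + 2)(r + 2c)(r − c)/r³ − 1) = (1 + 2ε)((c + 2) + (2c − 2c²)ε − 4c²ε²)`. -/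
theorem lower_envelope_eq_of_two_le {r c : ℝ} (hr : 0 < r) :
    (r + 2) * ((r + 2) * ((r + 2 * c) * (r - c) / r ^ 3) - 1)
      = (1 + 2 * (1 / r)) * ((c + 2) + (2 * c - 2 * c ^ 2) * (1 / r) - 4 * c ^ 2 * (1 / r) ^ 2) := by
  have hr0 : r ≠ 0 := hr.ne'
  field_simp
  ring

/-- The upper envelope of the mean phase outside the Jensen range, in `ε = 1/r`, `r > c ≥ 0`:
`(r + 2)((r + 2) r²/((r − c)²(r + c)) − 1) = (1 + 2ε)((2 + c) + c²ε − c³ε²)/((1 − cε)²(1 + cε))`. -/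
theorem upper_envelope_eq_of_two_le {r c : ℝ} (hc : 0 ≤ c) (hrc : c < r) :
    (r + 2) * ((r + 2) * (r ^ 2 / ((r - c) ^ 2 * (r + c))) - 1)
      = (1 + 2 * (1 / r)) * ((2 + c) + c ^ 2 * (1 / r) - c ^ 3 * (1 / r) ^ 2)
        / ((1 - c * (1 / r)) ^ 2 * (1 + c * (1 / r))) := by
  have hr : 0 < r := lt_of_le_of_lt hc hrc
  have hr0 : r ≠ 0 := hr.ne'
  have h1 : r - c ≠ 0 := by linarith
  have h2 : r + c ≠ 0 := by linarith
  have h3 : 1 - c * (1 / r) ≠ 0 := by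
    have : c * (1 / r) < 1 := by
      rw [mul_one_div, div_lt_one hr]
      exact hrc
    linarith
  have h4 : 1 + c * (1 / r) ≠ 0 := by
    have : 0 ≤ c * (1 / r) := by positivity
    linarith
  field_simp
  ring

section measure

variable [MeasurableSpace Circle] [BorelSpace Circle]

/-! ### The mean phase pinned -/

/-- **The normalised moments in the phase variable on the ray** (no restriction on `λ` beyond the ray):
`⟨(log|a|)ⁿ⟩_{k,λ} = ∫_0^∞ sⁿ e^{−(k−2)s} Φ_λ(s) ds / ∫_0^∞ e^{−(k−2)s} Φ_λ(s) ds`. -/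
theorem normalized_moment_eq_phase' (n : ℕ) {k lam : ℝ} (hk : 1 < k) (h1 : lam < k) (h2 : 2 < k + lam) :
    (∫ g, Real.log ‖mat g 0 0‖ ^ n * ((1 - ‖orbit g‖ ^ 2) ^ (k / 2) * sph lam g) ∂(nu haarCircle))
        / (∫ g, (1 - ‖orbit g‖ ^ 2) ^ (k / 2) * sph lam g ∂(nu haarCircle))
      = (∫ s in Ioi (0 : ℝ), s ^ n * Real.exp (-((k - 2) * s)) * sphPhase lam s)
        / ∫ s in Ioi (0 : ℝ), Real.exp (-((k - 2) * s)) * sphPhase lam s := by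
  rw [integral_log_pow_mul_orbit_rpow_mul_sph_eq_phase lam n hk h1 h2, jacobi_eq_laplace_phase hk h1 h2,
    mul_div_mul_left _ _ (by positivity : (2 * π : ℝ) ≠ 0)]

/-- **The mean phase from below outside the Jensen range**: for `λ ≥ 2`, `r = k − 2 > c'`,
`(r + 2c')(r − c')/r³ ≤ ⟨log|a|⟩_{k,λ}`. -/
theorem mean_phase_ge_of_two_le {k lam : ℝ} (h2 : 2 ≤ lam) (hk : lam * (lam - 2) / 2 < k - 2) :
    ((k - 2) + 2 * (lam * (lam - 2) / 2)) * ((k - 2) - lam * (lam - 2) / 2) / (k - 2) ^ 3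
      ≤ (∫ g, Real.log ‖mat g 0 0‖ * ((1 - ‖orbit g‖ ^ 2) ^ (k / 2) * sph lam g) ∂(nu haarCircle))
        / (∫ g, (1 - ‖orbit g‖ ^ 2) ^ (k / 2) * sph lam g ∂(nu haarCircle)) := by
  set c : ℝ := lam * (lam - 2) / 2 with hc
  have hc0 : 0 ≤ c := by rw [hc]; exact div_nonneg (mul_nonneg (by linarith) (by linarith)) (by norm_num)
  have hr : 0 < k - 2 := by linarith
  have hrc : 0 < k - 2 - c := by linarith
  have hk' : lam < k := by nlinarith
  have hm := normalized_moment_eq_phase' 1 (k := k) (lam := lam) (by linarith) hk' (by linarith)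
  simp only [pow_one] at hm
  rw [hm]
  have hA := le_moment_phase_of_two_le 1 h2 hk
  simp only [pow_one, Nat.factorial_one, Nat.cast_one, Nat.reduceAdd, Nat.factorial_two, Nat.cast_ofNat] at hA
  rw [← hc] at hA
  have hN := moment_phase_le_of_two_le 0 h2 hk
  simp only [pow_zero, one_mul, Nat.factorial_zero, Nat.cast_one, zero_add, pow_one] at hN
  rw [← hc] at hN
  have hNpos : 0 < ∫ s in Ioi (0 : ℝ), Real.exp (-((k - 2) * s)) * sphPhase lam s := by
    have h := le_moment_phase_of_two_le 0 h2 hk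
    simp only [pow_zero, one_mul, Nat.factorial_zero, Nat.cast_one, zero_add, pow_one, Nat.factorial_one,
      mul_one] at h
    refine lt_of_lt_of_le ?_ h
    positivity
  have hA' : ((k - 2) + 2 * c) / (k - 2) ^ 3
      ≤ ∫ s in Ioi (0 : ℝ), s * Real.exp (-((k - 2) * s)) * sphPhase lam s := by
    refine le_trans (le_of_eq ?_) hA
    field_simp
  have hnum : 0 ≤ ((k - 2) + 2 * c) / (k - 2) ^ 3 := by positivity
  rw [div_le_div_iff₀ (by positivity) hNpos]
  calc ((k - 2) + 2 * c) * ((k - 2) - c) * ∫ s in Ioi (0 : ℝ), Real.exp (-((k - 2) * s)) * sphPhase lam s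
      ≤ ((k - 2) + 2 * c) * ((k - 2) - c) * (1 / ((k - 2) - c)) :=
        mul_le_mul_of_nonneg_left hN (by positivity)
    _ = (((k - 2) + 2 * c) / (k - 2) ^ 3) * (k - 2) ^ 3 := by field_simp
    _ ≤ (∫ s in Ioi (0 : ℝ), s * Real.exp (-((k - 2) * s)) * sphPhase lam s) * (k - 2) ^ 3 :=
        mul_le_mul_of_nonneg_right hA' (by positivity)

/-- **The mean phase from above outside the Jensen range**: for `λ ≥ 2`, `r = k − 2 > c'`,
`⟨log|a|⟩_{k,λ} ≤ r²/((r − c')²(r + c'))`. -/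
theorem mean_phase_le_of_two_le {k lam : ℝ} (h2 : 2 ≤ lam) (hk : lam * (lam - 2) / 2 < k - 2) :
    (∫ g, Real.log ‖mat g 0 0‖ * ((1 - ‖orbit g‖ ^ 2) ^ (k / 2) * sph lam g) ∂(nu haarCircle))
        / (∫ g, (1 - ‖orbit g‖ ^ 2) ^ (k / 2) * sph lam g ∂(nu haarCircle))
      ≤ (k - 2) ^ 2 / (((k - 2) - lam * (lam - 2) / 2) ^ 2 * ((k - 2) + lam * (lam - 2) / 2)) := by
  set c : ℝ := lam * (lam - 2) / 2 with hc
  have hc0 : 0 ≤ c := by rw [hc]; exact div_nonneg (mul_nonneg (by linarith) (by linarith)) (by norm_num)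
  have hr : 0 < k - 2 := by linarith
  have hrc : 0 < k - 2 - c := by linarith
  have hk' : lam < k := by nlinarith
  have hm := normalized_moment_eq_phase' 1 (k := k) (lam := lam) (by linarith) hk' (by linarith)
  simp only [pow_one] at hm
  rw [hm]
  have hA := moment_phase_le_of_two_le 1 h2 hk
  simp only [pow_one, Nat.factorial_one, Nat.cast_one, Nat.reduceAdd] at hA
  rw [← hc] at hA
  have hN := le_moment_phase_of_two_le 0 h2 hk
  simp only [pow_zero, one_mul, Nat.factorial_zero, Nat.cast_one, zero_add, pow_one, Nat.factorial_one,
    mul_one] at hN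
  rw [← hc] at hN
  have hNpos : 0 < ∫ s in Ioi (0 : ℝ), Real.exp (-((k - 2) * s)) * sphPhase lam s :=
    lt_of_lt_of_le (by positivity) hN
  have hN' : ((k - 2) + c) / (k - 2) ^ 2 ≤ ∫ s in Ioi (0 : ℝ), Real.exp (-((k - 2) * s)) * sphPhase lam s := by
    refine le_trans (le_of_eq ?_) hN
    field_simp
  have hden : 0 < ((k - 2) - c) ^ 2 * ((k - 2) + c) := by positivity
  rw [div_le_div_iff₀ hNpos hden]
  calc (∫ s in Ioi (0 : ℝ), s * Real.exp (-((k - 2) * s)) * sphPhase lam s) * (((k - 2) - c) ^ 2 * ((k - 2) + c))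
      ≤ (1 / ((k - 2) - c) ^ 2) * (((k - 2) - c) ^ 2 * ((k - 2) + c)) :=
        mul_le_mul_of_nonneg_right hA hden.le
    _ = (k - 2) ^ 2 * (((k - 2) + c) / (k - 2) ^ 2) := by field_simp
    _ ≤ (k - 2) ^ 2 * ∫ s in Ioi (0 : ℝ), Real.exp (-((k - 2) * s)) * sphPhase lam s :=
        mul_le_mul_of_nonneg_left hN' (by positivity)

/-- **The next term of the mean phase outside the Jensen range**: for `λ ≥ 2`,
`k (k ⟨log|a|⟩_{k,λ} − 1) → 2 + c'` as `k → ∞`, `c' = λ(λ − 2)/2`. -/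
theorem tendsto_mul_mul_mean_phase_sub_one_of_two_le {lam : ℝ} (h2 : 2 ≤ lam) :
    Tendsto (fun k : ℝ => k * (k *
      ((∫ g, Real.log ‖mat g 0 0‖ * ((1 - ‖orbit g‖ ^ 2) ^ (k / 2) * sph lam g) ∂(nu haarCircle))
        / (∫ g, (1 - ‖orbit g‖ ^ 2) ^ (k / 2) * sph lam g ∂(nu haarCircle))) - 1))
      atTop (𝓝 (2 + lam * (lam - 2) / 2)) := by
  set c : ℝ := lam * (lam - 2) / 2 with hc
  have hc0 : 0 ≤ c := by rw [hc]; exact div_nonneg (mul_nonneg (by linarith) (by linarith)) (by norm_num)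
  have hε := tendsto_one_div_sub_two
  have hL : Tendsto (fun ε : ℝ => (1 + 2 * ε) * ((c + 2) + (2 * c - 2 * c ^ 2) * ε - 4 * c ^ 2 * ε ^ 2))
      (𝓝 0) (𝓝 (2 + c)) := by
    have hcont : Continuous fun ε : ℝ => (1 + 2 * ε) * ((c + 2) + (2 * c - 2 * c ^ 2) * ε - 4 * c ^ 2 * ε ^ 2) := by
      fun_prop
    have := hcont.continuousAt.tendsto (x := 0)
    norm_num at this
    rw [show 2 + c = c + 2 by ring]
    exact this
  have hU : Tendsto (fun ε : ℝ => (1 + 2 * ε) * ((2 + c) + c ^ 2 * ε - c ^ 3 * ε ^ 2)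
      / ((1 - c * ε) ^ 2 * (1 + c * ε))) (𝓝 0) (𝓝 (2 + c)) := by
    have hcont : ContinuousAt (fun ε : ℝ => (1 + 2 * ε) * ((2 + c) + c ^ 2 * ε - c ^ 3 * ε ^ 2)
        / ((1 - c * ε) ^ 2 * (1 + c * ε))) 0 := by
      apply ContinuousAt.div
      · fun_prop
      · fun_prop
      · norm_num
    have := hcont.tendsto
    norm_num at this
    exact this
  refine tendsto_of_tendsto_of_tendsto_of_le_of_le' (hL.comp hε) (hU.comp hε) ?_ ?_
  · filter_upwards [eventually_gt_atTop (c + 2)] with k hk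
    have hr : 0 < k - 2 := by linarith
    have hk0 : 0 < k := by linarith
    simp only [Function.comp_apply]
    rw [← lower_envelope_eq_of_two_le (c := c) hr, show k - 2 + 2 = k by ring]
    have := mean_phase_ge_of_two_le h2 (by rw [← hc]; linarith)
    rw [← hc] at this
    have hkk : 0 ≤ k * k := by positivity
    nlinarith [mul_le_mul_of_nonneg_left this hkk]
  · filter_upwards [eventually_gt_atTop (c + 2)] with k hk
    have hr : 0 < k - 2 := by linarith
    have hk0 : 0 < k := by linarith
    simp only [Function.comp_apply]
    rw [← upper_envelope_eq_of_two_le (c := c) hc0 (by linarith), show k - 2 + 2 = k by ring]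
    have := mean_phase_le_of_two_le h2 (by rw [← hc]; linarith)
    rw [← hc] at this
    have hkk : 0 ≤ k * k := by positivity
    nlinarith [mul_le_mul_of_nonneg_left this hkk]

/-- **The next term of the mean phase for `λ ≤ 0`**: `k (k ⟨log|a|⟩_{k,λ} − 1) → 2 + c'`. -/
theorem tendsto_mul_mul_mean_phase_sub_one_of_nonpos {lam : ℝ} (h0 : lam ≤ 0) :
    Tendsto (fun k : ℝ => k * (k *
      ((∫ g, Real.log ‖mat g 0 0‖ * ((1 - ‖orbit g‖ ^ 2) ^ (k / 2) * sph lam g) ∂(nu haarCircle))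
        / (∫ g, (1 - ‖orbit g‖ ^ 2) ^ (k / 2) * sph lam g ∂(nu haarCircle))) - 1))
      atTop (𝓝 (2 + lam * (lam - 2) / 2)) := by
  have e : (2 - lam) * (2 - lam - 2) / 2 = lam * (lam - 2) / 2 := by ring
  have h := tendsto_mul_mul_mean_phase_sub_one_of_two_le (lam := 2 - lam) (by linarith)
  rw [e] at h
  simp_rw [← sph_two_sub lam] at h
  exact h

/-- **THE NEXT TERM OF THE MEAN PHASE, FOR EVERY REAL `λ`**: `k (k ⟨log|a|⟩_{k,λ} − 1) → 2 + λ(λ − 2)/2` as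
`k → ∞`, i.e. `⟨log|a|⟩_{k,λ} = 1/k + (2 + λ(λ − 2)/2)/k² + o(1/k²)` — on `0 ≤ λ ≤ 2` this is
`T5SU11JacobiPhaseSecondOrder.tendsto_mul_mul_mean_phase_sub_one` (`2 − c`, `c = λ(2 − λ)/2`). -/
theorem tendsto_mul_mul_mean_phase_sub_one_all (lam : ℝ) :
    Tendsto (fun k : ℝ => k * (k *
      ((∫ g, Real.log ‖mat g 0 0‖ * ((1 - ‖orbit g‖ ^ 2) ^ (k / 2) * sph lam g) ∂(nu haarCircle))
        / (∫ g, (1 - ‖orbit g‖ ^ 2) ^ (k / 2) * sph lam g ∂(nu haarCircle))) - 1))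
      atTop (𝓝 (2 + lam * (lam - 2) / 2)) := by
  rcases le_or_gt lam 0 with h0 | h0
  · exact tendsto_mul_mul_mean_phase_sub_one_of_nonpos h0
  rcases le_or_gt 2 lam with h2 | h2
  · exact tendsto_mul_mul_mean_phase_sub_one_of_two_le h2
  have h := tendsto_mul_mul_mean_phase_sub_one h0.le h2.le
  rwa [show 2 - lam * (2 - lam) / 2 = 2 + lam * (lam - 2) / 2 by ring] at h

end measure

end Summit.Ventures.HodgeRepro2.T5SU11JacobiMeanPhaseOutside
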